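import Mathlib
import Literature.Analysis.ValidatedNumerics.WeightedEllOneKernelComposition
import HarnessLib

/-!
# Weighted `ℓ¹` tail bounds: the rational far-column factor, certified suprema of
# polynomial × geometric weights, diagonal weight transfer

Sequel of `WeightedEllOneKernelComposition.lean` (kernel composition, the `Z₁` kernel
`oneSubKer A M = I − A·M`, the far-column lemma `far_column_tsum_le`).  This file supplies the
CLOSED FORMS that a certificate's bookkeeping asserts in prose:

1. **The far-column factor** (`quad_div_sq_antitone`): for `a, b, c, D ≥ 0` the function
   `j ↦ (a j² + b j + c)/(j − D)²` is non-increasing on `j > D` — so the bound of the first far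
   column bounds every later one ("evaluate at `j₀`, monotone beyond"); and
   `add_pow_div_sq_antitone`: `(y + k)^p/y² ≤ (x + k)^p/x²` for `0 < x ≤ y`, `k ≥ 0`, `p ≤ 2`
   (the first tail row is the worst row for a coefficient-error column of order `≤ 2`).
2. **Certified suprema** (`succ_pow_mul_le_pow`, `pow_mul_pow_antitone_from`,
   `pow_mul_pow_le_of_scan`): the sequence `k ↦ (K + k)^m t^k` (`0 ≤ t`, `0 ≤ K`) is
   non-increasing from the first index `k₀` at which the ratio test
   `(K + k₀ + 1)^m · t ≤ (K + k₀)^m` holds; hence `sup_k (K+k)^m t^k = max_{k ≤ k₀}` — a finite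
   scan plus ONE inequality certifies the supremum.  This is the discrete (rational, decidable over
   `ℚ`) form of the logarithmic threshold `M ≥ −s/ln θ − m` of
   [BredenDesvillettesLessard2015, Prop. 3.10]; it certifies constants such as
   `κ_m = sup_k k^m (ν/ν₂)^k` and `sup_{j>K} j^m ν^{−2(j−K)}`.
3. **Diagonal multipliers / weight transfer** (`wnorm_diag_le`, `wnorm_natPow_mul_le`):
   `|λ_k| ω′(k) ≤ κ ω(k)` for all `k` gives `‖(λ_k a_k)_k‖_{ω′} ≤ κ ‖a‖_ω`; with `λ_k = k^m`,
   `ω = ν₂^k`, `ω′ = ν^k` this is the derivative transfer `‖(k^m a_k)‖_ν ≤ κ_m ‖a‖_{ν₂}`.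
4. **The `ℕ`-indexed far-column bound** (`far_column_nat`, `far_columns_uniform`): block modes
   `{0,…,K}`, tail `d(k) = 1/k²`, banded remainder with `Σ_k |R(k,m)| ν^k ≤ (a m² + b m + c) ν^m`
   ⇒ every far column `m > K + D` of `I − A·M` has weighted norm `≤ (a m² + b m + c)/(m − D)² ν^m`,
   and for `m ≥ j₀ > K + D` this is at most the value at `j₀`.

## Sources and verbatim statements

* [BredenDesvillettesLessard2015] M. Breden, L. Desvillettes, J.-P. Lessard, *Rigorous numerics
  for nonlinear operators with tridiagonal dominant linear part*, DCDS-A 35 (2015) 4765–4789,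
  Proposition 3.10 (arXiv:1503.06315 pp. 10–11): "Consider an integer `M` such that
  `M ≥ max(−s/ln θ − m, m − 2)` (3.20) and define … `Y_{m+k} := Y_{m+M} ω^s_{m+M}/ω^s_{m+k}` for
  all `k > M`.  Then `|T(x̄) − x̄| ≤ Y`."  Proof, last line: "by (3.20),
  `θ^k (m+k)^s ≤ θ^M (m+M)^s` for all `k > M`".  Item 2 proves this monotone-tail statement
  from a RATIONAL ratio test instead of the logarithmic threshold (no `ln` to enclose).
* [HungriaLessardMirelesJames2016] A. Hungria, J.-P. Lessard, J. D. Mireles James, *Rigorous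
  numerics for analytic solutions of differential equations: the radii polynomial approach*,
  Math. Comp. 85 (2016) 1427–1459: Corollary 1 p. 1434 (block ⊕ diagonal-tail operator norm);
  §5.2 p. 1453–1454 (the tail rows of `I − A·DF` are the lower-order operator divided by the
  symbol `μ_m`) — see the verbatim quotes in `WeightedEllOneKernelComposition.lean`; §2.1
  p. 1433: "if `ν ≥ 1` and `a, b ∈ ℓ¹_ν`, then `a ∗ b ∈ ℓ¹_ν` and `‖a ∗ b‖_ν ≤ ‖a‖_ν ‖b‖_ν`"
  (the weight algebra in which the transfer constants of item 3 are used).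

## Instance of record (quoted, not part of any statement)

The first client is the F2 step 2a (A) certificate of cell certnum / seat certnum-ode-2
(`pub/certnum/certnum-ode-2/evidence/f2A-iter-run1/boundsA_ITER-like_nu11o10.json`, sha16
`a8624a68f47a3037`; certificate `certA_ITER-like_nu11o10_run1.json` `8516d34e718168b5`):
`X = (ℓ¹_ν(cos))⁴`, `ν = 11/10 < ν₂ = 6/5`, block `K = 80`, bandwidth `D_max = 579`, enumerated
columns `K < m ≤ K + BW_e` with `BW_e = 1158`, far columns from `j₀ = K + BW_e + 1 = 1239` with
`a = ‖ε‖_ν ≈ 6.69·10⁻¹²`, `b = N₁ ≈ 15.69`, `c = N₀ ≈ 43.39`, giving `Z_far ≈ 0.0447` beside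
`Z_block ≈ 0.0916`, `Z_tail ≈ 0.1539`, `Z_err ≈ 1.2·10⁻⁶`, `Z ≈ 0.15390 < 1`; derivative transfer
`t = ν/ν₂ = 11/12`, `κ₁ ≈ 4.224`, `κ₂ ≈ 71.50`.  Those numbers belong to the client's ledger; this
file states only the inequalities they instantiate.

## What is NOT here (scope)

* `far_column_nat` fixes the tail `d(k) = 1/k²` (second-order symbol `k²`); other symbols go
  through the general `far_column_tsum_le`.  The junk value `d(0) = 1/0 = 0` is never used
  (`0` is a block mode).
* No client-specific operator: the aggregates `a, b, c` (norms of the second/first/zeroth-order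
  lower-order coefficients with their `k`-factors) and the bandwidth `D` are hypotheses.

## Provenance

AI-produced formalisation (cell certnum, seat certnum-lean-3, 2026-08-27), written as the typed
soundness layer under steps (2) (derivative transfer `κ_m = max_k k^m (ν/ν₂)^k`) and (6) (far
columns `(j₀²‖ε‖_ν + j₀N₁ + N₀)/(j₀ − D_max)²`, "monotone beyond `j₀`"; sup constants `W_b`, `W_t`)
of `pub/certnum/ode/F2-ROUTE-A.md` §4 (A″).  Every public statement is PROVED and tagged with the
published statement it generalises or discretises.
-/

set_option autoImplicit false

open scoped BigOperators ENNReal NNReal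
open Finset

noncomputable section

namespace Literature.Analysis.ValidatedNumerics.WeightedSeq

variable {ι : Type*}

/-! ### 1. Closed forms: the rational tail factor and certified suprema -/

section ClosedForms

/-- **The far-column factor is non-increasing**: for `a, b, c, D ≥ 0` the function
`j ↦ (a j² + b j + c)/(j − D)²` is non-increasing on `j > D`; hence its value at the first far
column bounds it at all later columns ("evaluate at `j₀`, monotone beyond").
[cite: HungriaLessardMirelesJames2016, §5.2 p. 1454] -/
theorem quad_div_sq_antitone {a b c D x y : ℝ} (ha : 0 ≤ a) (hb : 0 ≤ b) (hc : 0 ≤ c)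
    (hD : 0 ≤ D) (hx : D < x) (hxy : x ≤ y) :
    (a * y ^ 2 + b * y + c) / (y - D) ^ 2 ≤ (a * x ^ 2 + b * x + c) / (x - D) ^ 2 := by
  have hu : 0 < x - D := sub_pos.2 hx
  have hv : 0 < y - D := by linarith
  -- rewrite both sides in terms of p = t/(t-D) and r = 1/(t-D)
  have key : ∀ t : ℝ, 0 < t - D →
      (a * t ^ 2 + b * t + c) / (t - D) ^ 2 =
        a * (t / (t - D)) ^ 2 + b * ((t / (t - D)) * (1 / (t - D))) + c * (1 / (t - D)) ^ 2 := by
    intro t ht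
    field_simp
  rw [key y hv, key x hu]
  have hp : y / (y - D) ≤ x / (x - D) := by
    rw [div_le_div_iff₀ hv hu]; nlinarith
  have hp0 : 0 ≤ y / (y - D) := div_nonneg (by linarith) hv.le
  have hr : 1 / (y - D) ≤ 1 / (x - D) := one_div_le_one_div_of_le hu (by linarith)
  have hr0 : 0 ≤ 1 / (y - D) := by positivity
  have h1 : (y / (y - D)) ^ 2 ≤ (x / (x - D)) ^ 2 := pow_le_pow_left₀ hp0 hp 2
  have h2 : y / (y - D) * (1 / (y - D)) ≤ x / (x - D) * (1 / (x - D)) :=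
    mul_le_mul hp hr hr0 (hp0.trans hp)
  have h3 : (1 / (y - D)) ^ 2 ≤ (1 / (x - D)) ^ 2 := pow_le_pow_left₀ hr0 hr 2
  gcongr

/-- **Ratio step**: if `(x₀ + 1)^m t ≤ x₀^m` with `0 ≤ x₀`, then `(x + 1)^m t ≤ x^m` for every
`x ≥ x₀` (because `x ↦ x/(x+1)` is increasing) — the one-step form of the monotone tail
"`θ^k (m+k)^s ≤ θ^M (m+M)^s` for all `k > M`". [cite: BredenDesvillettesLessard2015, Prop. 3.10 (3.20)] -/
theorem succ_pow_mul_le_pow {t x₀ x : ℝ} (m : ℕ) (hx₀ : 0 ≤ x₀) (hx : x₀ ≤ x)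
    (h : (x₀ + 1) ^ m * t ≤ x₀ ^ m) : (x + 1) ^ m * t ≤ x ^ m := by
  have hx0' : 0 < x₀ + 1 := by linarith
  have hx' : 0 < x + 1 := by linarith
  have h1 : t ≤ (x₀ / (x₀ + 1)) ^ m := by
    rw [div_pow, le_div_iff₀ (pow_pos hx0' m)]; linarith
  have h2 : x₀ / (x₀ + 1) ≤ x / (x + 1) := by
    rw [div_le_div_iff₀ hx0' hx']; nlinarith
  have h3 : (x₀ / (x₀ + 1)) ^ m ≤ (x / (x + 1)) ^ m :=
    pow_le_pow_left₀ (div_nonneg hx₀ hx0'.le) h2 m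
  have h4 : t ≤ x ^ m / (x + 1) ^ m := by rw [← div_pow]; exact h1.trans h3
  rw [le_div_iff₀ (pow_pos hx' m)] at h4
  linarith [h4]

/-- **Monotone tail of `k ↦ (K + k)^m t^k` from a ratio test**: if `0 ≤ t`, `0 ≤ K` and at some
index `k₀` the ratio test `(K + k₀ + 1)^m t ≤ (K + k₀)^m` holds, then the sequence is
non-increasing from `k₀` on: `(K + k)^m t^k ≤ (K + k₀)^m t^{k₀}` for all `k ≥ k₀`.  This is the
statement "`θ^k (m+k)^s ≤ θ^M (m+M)^s` for all `k > M`" of the source, obtained there from the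
logarithmic threshold `M ≥ −s/ln θ − m`; the ratio test is its rational (decidable over `ℚ`)
replacement. [cite: BredenDesvillettesLessard2015, Prop. 3.10 (3.20)] -/
theorem pow_mul_pow_antitone_from {t K : ℝ} (ht : 0 ≤ t) (hK : 0 ≤ K) (m k₀ : ℕ)
    (hratio : (K + k₀ + 1) ^ m * t ≤ (K + k₀) ^ m) :
    ∀ k : ℕ, k₀ ≤ k → (K + k) ^ m * t ^ k ≤ (K + k₀) ^ m * t ^ k₀ := by
  intro k hk
  induction k, hk using Nat.le_induction with
  | base => exact le_rfl
  | succ k hk ih =>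
    have hk' : (k₀ : ℝ) ≤ k := by exact_mod_cast hk
    have hstep : (K + (k : ℝ) + 1) ^ m * t ≤ (K + (k : ℝ)) ^ m :=
      succ_pow_mul_le_pow m (by positivity) (by linarith) hratio
    calc (K + ((k + 1 : ℕ) : ℝ)) ^ m * t ^ (k + 1)
        = ((K + (k : ℝ) + 1) ^ m * t) * t ^ k := by push_cast; ring
      _ ≤ (K + (k : ℝ)) ^ m * t ^ k := mul_le_mul_of_nonneg_right hstep (pow_nonneg ht k)
      _ ≤ (K + k₀) ^ m * t ^ k₀ := ih

/-- **Certified supremum by a finite scan**: under the ratio test at `k₀`, a bound `B` valid for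
the finitely many terms `k ≤ k₀` is valid for ALL `k`:
`sup_k (K + k)^m t^k = max_{k ≤ k₀} (K + k)^m t^k ≤ B`.  This certifies constants such as
`κ_m = sup_k k^m (ν/ν₂)^k` (derivative / weight transfer, `K = 0`) and
`sup_{j > K} j^m ν^{−2(j−K)}` by a terminating scan plus one inequality.
[cite: BredenDesvillettesLessard2015, Prop. 3.10 (3.20)] -/
theorem pow_mul_pow_le_of_scan {t K B : ℝ} (ht : 0 ≤ t) (hK : 0 ≤ K) (m k₀ : ℕ)
    (hratio : (K + k₀ + 1) ^ m * t ≤ (K + k₀) ^ m)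
    (hscan : ∀ k : ℕ, k ≤ k₀ → (K + k) ^ m * t ^ k ≤ B) :
    ∀ k : ℕ, (K + k) ^ m * t ^ k ≤ B := by
  intro k
  by_cases hk : k ≤ k₀
  · exact hscan k hk
  · exact (pow_mul_pow_antitone_from ht hK m k₀ hratio k (not_le.mp hk).le).trans
      (hscan k₀ le_rfl)

/-- **The first tail row is the worst one**: for `0 < x ≤ y`, `0 ≤ k` and an order `p ≤ 2`,
`(y + k)^p / y² ≤ (x + k)^p / x²` — the factor `(row + offset)^{ord} / row²` produced by a
coefficient-error column of order `ord ≤ 2` hitting the diagonal tail `1/row²` is largest at the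
first tail row.  Together with `pow_mul_pow_le_of_scan` (in the offset) this certifies the
`sup`-constants of the coefficient-error term of a `Z`-bound by finitely many evaluations.
[cite: HungriaLessardMirelesJames2016, §5.2 p. 1454] -/
theorem add_pow_div_sq_antitone {x y k : ℝ} (p : ℕ) (hp : p ≤ 2) (hx : 0 < x) (hxy : x ≤ y)
    (hk : 0 ≤ k) : (y + k) ^ p / y ^ 2 ≤ (x + k) ^ p / x ^ 2 := by
  have hy : 0 < y := lt_of_lt_of_le hx hxy
  rw [div_le_div_iff₀ (pow_pos hy 2) (pow_pos hx 2)]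
  interval_cases p
  · nlinarith [mul_le_mul hxy hxy hx.le hy.le]
  · simp only [pow_one]
    nlinarith [mul_nonneg (mul_nonneg hx.le hy.le) (sub_nonneg.2 hxy),
      mul_nonneg hk (mul_nonneg (sub_nonneg.2 hxy) (add_pos hx hy).le)]
  · have h1 : (y + k) * x ≤ (x + k) * y := by nlinarith
    have h2 : ((y + k) * x) ^ 2 ≤ ((x + k) * y) ^ 2 := pow_le_pow_left₀ (by positivity) h1 2
    nlinarith [h2]

end ClosedForms

/-! ### 2. Diagonal multipliers and weight transfer -/

section Diagonal

variable {ω ω' : ι → ℝ}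

/-- **Diagonal multiplier between two weights**: if `|λ_i| ω′(i) ≤ κ ω(i)` for every index then
`a ↦ (λ_i a_i)_i` maps `ℓ¹_ω` into `ℓ¹_{ω′}` with `‖λ·a‖_{ω′} ≤ κ ‖a‖_ω`.  (The diagonal case of the
column-bound principle `wnorm_apply_le`, proved directly so that no positivity of the weights is
needed.) [cite: HungriaLessardMirelesJames2016, Cor. 1 p. 1434] -/
theorem wnorm_diag_le (hω' : ∀ i, 0 ≤ ω' i) {lam : ι → ℝ} {κ : ℝ}
    (h : ∀ i, |lam i| * ω' i ≤ κ * ω i) {a : ι → ℝ} (ha : Mem ω a) :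
    Mem ω' (fun i => lam i * a i) ∧ wnorm ω' (fun i => lam i * a i) ≤ κ * wnorm ω a := by
  have hle : ∀ i, |lam i * a i| * ω' i ≤ κ * (|a i| * ω i) := by
    intro i
    rw [abs_mul]
    calc |lam i| * |a i| * ω' i = |a i| * (|lam i| * ω' i) := by ring
      _ ≤ |a i| * (κ * ω i) := mul_le_mul_of_nonneg_left (h i) (abs_nonneg _)
      _ = κ * (|a i| * ω i) := by ring
  have hnn : ∀ i, 0 ≤ |lam i * a i| * ω' i := fun i => mul_nonneg (abs_nonneg _) (hω' i)
  have hmem : Mem ω' (fun i => lam i * a i) := (ha.mul_left κ).of_nonneg_of_le hnn hle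
  refine ⟨hmem, ?_⟩
  calc wnorm ω' (fun i => lam i * a i) = ∑' i, |lam i * a i| * ω' i := rfl
    _ ≤ ∑' i, κ * (|a i| * ω i) := hmem.tsum_le_tsum hle (ha.mul_left κ)
    _ = κ * wnorm ω a := by rw [tsum_mul_left]; rfl

/-- **Derivative / weight transfer on `ℕ`**: if `k^m (ν/ν₂)^k ≤ κ` for all `k` (a constant that
`pow_mul_pow_le_of_scan` certifies), then `‖(k^m a_k)_k‖_ν ≤ κ ‖a‖_{ν₂}` for `a ∈ ℓ¹_{ν₂}`
(`0 ≤ ν`, `0 < ν₂`): the `m`-th derivative symbol costs the factor `κ` when passing from the weight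
`ν₂` to the smaller working weight `ν`. [cite: HungriaLessardMirelesJames2016, §2.1 p. 1433–1434] -/
theorem wnorm_natPow_mul_le {ν ν₂ κ : ℝ} (hν : 0 ≤ ν) (hν₂ : 0 < ν₂) (m : ℕ)
    (hκ : ∀ k : ℕ, (k : ℝ) ^ m * (ν / ν₂) ^ k ≤ κ) {a : ℕ → ℝ} (ha : Mem (fun k => ν₂ ^ k) a) :
    Mem (fun k => ν ^ k) (fun k : ℕ => (k : ℝ) ^ m * a k) ∧
      wnorm (fun k => ν ^ k) (fun k : ℕ => (k : ℝ) ^ m * a k) ≤ κ * wnorm (fun k => ν₂ ^ k) a := by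
  refine wnorm_diag_le (fun k => pow_nonneg hν k) (fun k => ?_) ha
  have hk := hκ k
  rw [div_pow] at hk
  have hν₂k : 0 < ν₂ ^ k := pow_pos hν₂ k
  rw [abs_of_nonneg (pow_nonneg (Nat.cast_nonneg k) m)]
  have h2 := mul_le_mul_of_nonneg_right hk hν₂k.le
  calc (k : ℝ) ^ m * ν ^ k = (k : ℝ) ^ m * (ν ^ k / ν₂ ^ k) * ν₂ ^ k := by
        field_simp
    _ ≤ κ * ν₂ ^ k := h2

end Diagonal

/-! ### 3. The `ℕ`-indexed far-column bound with tail `d(k) = 1/k²` and bandwidth `D` -/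

section NatTail

/-- **Far columns of `I − (A_K ⊕ diag(1/k²))·M` for a banded `M` on `ℓ¹_ν(ℕ)`.**  Block modes
`S = {0,…,K}`, tail multipliers `d(k) = 1/k²`; column `m` of `M` has the symbol `m²` on the
diagonal and a remainder `R(·,m)` supported in the rows `k ≥ m − D` (bandwidth `D` below the
diagonal, anything above), with weighted norm `Σ_k |R(k,m)| ν^k ≤ (a m² + b m + c) ν^m`
(`a, b, c` = norms of the second/first/zeroth-order lower-order coefficients with their
`k`-factors).  Then for every far column `m > K + D` (so that the block rows are provably empty)
`Σ_k |(I − A·M)(k,m)| ν^k ≤ (a m² + b m + c)/(m − D)² · ν^m`.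
[cite: HungriaLessardMirelesJames2016, §5.2 p. 1453–1454] -/
theorem far_column_nat {ν : ℝ} (hν : 0 ≤ ν) (K D : ℕ) (AK : ℕ → ℕ → ℝ) {M R : ℕ → ℕ → ℝ}
    {m : ℕ} {a b c : ℝ} (hfar : K + D < m)
    (hsplit : ∀ k, M k m = (if k = m then ((m : ℝ) ^ 2) else 0) + R k m)
    (hband : ∀ k, R k m ≠ 0 → m ≤ k + D)
    (hR : (Summable fun k => |R k m| * ν ^ k) ∧
      ∑' k, |R k m| * ν ^ k ≤ (a * (m : ℝ) ^ 2 + b * m + c) * ν ^ m) :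
    (Summable fun k =>
        |oneSubKer (blockDiag (Finset.range (K + 1)) AK (fun k => 1 / (k : ℝ) ^ 2)) M k m| * ν ^ k) ∧
      ∑' k, |oneSubKer (blockDiag (Finset.range (K + 1)) AK (fun k => 1 / (k : ℝ) ^ 2)) M k m| * ν ^ k
        ≤ (a * (m : ℝ) ^ 2 + b * m + c) / ((m : ℝ) - D) ^ 2 * ν ^ m := by
  have hmK : m ∉ Finset.range (K + 1) := by
    rw [Finset.mem_range]; omega
  have hm0 : (0 : ℝ) < (m : ℝ) - D := by
    have : (D : ℝ) < m := by exact_mod_cast (lt_of_le_of_lt (Nat.le_add_left D K) hfar)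
    linarith
  have hRsupp : ∀ k, R k m ≠ 0 → K < k := fun k hk => by have := hband k hk; omega
  have hcol : ∀ j ∈ Finset.range (K + 1), M j m = 0 := by
    intro j hj
    rw [Finset.mem_range] at hj
    have hjm : j ≠ m := by omega
    rw [hsplit j, if_neg hjm, zero_add]
    by_contra hR0
    have := hRsupp j hR0
    omega
  have hsplit' : ∀ k, k ∉ Finset.range (K + 1) →
      M k m = (if k = m then ((m : ℝ) ^ 2) else 0) + R k m := fun k _ => hsplit k
  have hμ : (1 / (m : ℝ) ^ 2) * (m : ℝ) ^ 2 = 1 := by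
    have : (0 : ℝ) < m := by exact_mod_cast (lt_of_le_of_lt (Nat.zero_le _) hfar)
    field_simp
  have hδ0 : 0 ≤ 1 / ((m : ℝ) - D) ^ 2 := by positivity
  have hδ : ∀ k, k ∉ Finset.range (K + 1) → R k m ≠ 0 → |1 / (k : ℝ) ^ 2| ≤ 1 / ((m : ℝ) - D) ^ 2 := by
    intro k _ hk
    have hkD : m ≤ k + D := hband k hk
    have hk' : (m : ℝ) - D ≤ k := by
      have : (m : ℝ) ≤ (k : ℝ) + D := by exact_mod_cast hkD
      linarith
    have hkpos : (0 : ℝ) < k := lt_of_lt_of_le hm0 hk'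
    rw [abs_of_nonneg (by positivity)]
    exact one_div_le_one_div_of_le (pow_pos hm0 2) (pow_le_pow_left₀ hm0.le hk' 2)
  have h := far_column_tsum_le (fun k => pow_nonneg hν k) (Finset.range (K + 1)) AK
    (fun k => 1 / (k : ℝ) ^ 2) hmK hcol hsplit' hμ hδ0 hδ hR
  refine ⟨h.1, h.2.trans_eq ?_⟩
  ring

/-- **One evaluation bounds every far column**: with `a, b, c ≥ 0`, for all far columns
`m ≥ j₀ > K + D` the bound of `far_column_nat` is at most its value at `j₀`,
`(a j₀² + b j₀ + c)/(j₀ − D)²` — so the far-column contribution to `Z` is this one number.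
[cite: HungriaLessardMirelesJames2016, §5.2 p. 1453–1454] -/
theorem far_columns_uniform {ν : ℝ} (hν : 0 ≤ ν) (K D j₀ : ℕ) (AK : ℕ → ℕ → ℝ)
    {M R : ℕ → ℕ → ℝ} {a b c : ℝ} (ha : 0 ≤ a) (hb : 0 ≤ b) (hc : 0 ≤ c) (hj₀ : K + D < j₀)
    (hsplit : ∀ m k, j₀ ≤ m → M k m = (if k = m then ((m : ℝ) ^ 2) else 0) + R k m)
    (hband : ∀ m k, j₀ ≤ m → R k m ≠ 0 → m ≤ k + D)
    (hR : ∀ m, j₀ ≤ m → (Summable fun k => |R k m| * ν ^ k) ∧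
      ∑' k, |R k m| * ν ^ k ≤ (a * (m : ℝ) ^ 2 + b * m + c) * ν ^ m) :
    ∀ m, j₀ ≤ m →
      (Summable fun k =>
        |oneSubKer (blockDiag (Finset.range (K + 1)) AK (fun k => 1 / (k : ℝ) ^ 2)) M k m| * ν ^ k) ∧
      ∑' k, |oneSubKer (blockDiag (Finset.range (K + 1)) AK (fun k => 1 / (k : ℝ) ^ 2)) M k m| * ν ^ k
        ≤ (a * (j₀ : ℝ) ^ 2 + b * j₀ + c) / ((j₀ : ℝ) - D) ^ 2 * ν ^ m := by
  intro m hm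
  have h := far_column_nat hν K D AK (m := m) (by omega) (fun k => hsplit m k hm)
    (fun k => hband m k hm) (hR m hm)
  refine ⟨h.1, h.2.trans (mul_le_mul_of_nonneg_right ?_ (pow_nonneg hν m))⟩
  have hDj : (D : ℝ) < j₀ := by exact_mod_cast (lt_of_le_of_lt (Nat.le_add_left D K) hj₀)
  have hjm : (j₀ : ℝ) ≤ m := by exact_mod_cast hm
  exact quad_div_sq_antitone ha hb hc (Nat.cast_nonneg D) hDj hjm

end NatTail

end Literature.Analysis.ValidatedNumerics.WeightedSeq

end
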